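import Mathlib
import HarnessLib
import Summits.HubbardSuperconductivity.HubbardSuperconductivity.Theorems.KLProgrammeKLRegimeEngineFrameShiftSymbolMomentsFlow

/-!
# KL programme — K3 ENGINE child (`KLRegimeEngineV17F2`, stmt-HubbardSuperconductivity-20437), stub (b) weighted lines, cure (c-D): the DATA of the
# `m`-th flow-piece increment — the band increment `e_{K_{m+1}} − e_{K_m} = evalM (klFlowPiece m)` and its jets from (I-F jets), and the
# truncated band jets of the partial flow frame `K_m`

Cell `gate-hubbard-kl`, seat hubbard-kl-k3c3-p2 (g8); v2 conditional token #19; located risk «(b)-Wt@j≥1», evidence #48 CD-LIMITS.  The increment pair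
bound `TorusFourierL2.sliceIncrPairWt_charSum_l1_le` (frames `K, K′`) reads the piece `v = frameLevel μ K′ − frameLevel μ K` through `|v| ≤ P₀`,
`‖Dv‖ ≤ P₁`, `‖D²v‖ ≤ P₂`, `‖D³v‖ ≤ P₃` and the band `frameLevel μ K` through `‖D^i‖ ≤ K_iᵇ`.  On the flow `K = K_m`, `K′ = K_{m+1}`:

* **`frameLevel_klFlowFrameU_succ_sub`** — `frameLevel μ K_{m+1} − frameLevel μ K_m = evalM (klFlowPiece m)` (as functions: `K_{m+1} = K_m ⊖ p_m` and
  `e_K = e_0 − evalM K`);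
* **`flowPiece_increment_data`** — from `FlowPieceJetsAt … R m`: `P_i = R.Gfr i · uPow i U · 4^{(i−2)m}`, `i = 0,…,3` (in the `|·|`, `‖fderiv‖`, `‖D²‖`,
  `‖D³‖` forms the pair lemma consumes);
* **`flowFrame_band_data`** — from `FlowPieceJetsAt … R m′` for all `m′ < m`: `‖D^i frameLevel μ K_m‖ ≤ 4 + Σ_{m′<m} R.Gfr i · uPow i U · 4^{(i−2)m′}`,
  `i = 1, 2, 3` (TRUNCATED at `m`: the third derivative of a partial frame is `≲ Gfr₃U²4^m/3`, which is what keeps the base piece at `K_{m₀(j)}` harmless).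

Everything is proved; no definitions, no sorry.  Nothing asserts superconductivity.
-/

noncomputable section

namespace Summit.HubbardSuperconductivity.HubbardSuperconductivity.Theorems.EngineV8

set_option linter.dupNamespace false -- summit = problem name (single-conjunct summit), D-0017

open Real Finset Literature.MathematicalPhysics.QuantumLattice Literature.Probability.LatticeModels
open Summit.HubbardSuperconductivity.HubbardSuperconductivity.Theorems.DispersionFlow
open Summit.HubbardSuperconductivity.HubbardSuperconductivity.Theorems.KLRegimeSplit

variable {L M : ℕ} [NeZero L] [NeZero M]

/-! ## §1 The band increment of one flow step is the flow piece -/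

/-- **`e_{K_{m+1}} − e_{K_m} = evalM (klFlowPiece m)`** as functions on `Momentum`. -/
theorem frameLevel_klFlowFrameU_succ_sub (β U μ : ℝ) (m : ℕ) :
    (fun q : Momentum => frameLevel μ (klFlowFrameU L M β U μ (m + 1)) q - frameLevel μ (klFlowFrameU L M β U μ m) q) =
      evalM (klFlowPiece L M β U μ m) := by
  funext q
  rw [frameLevel_eq_zero_sub_evalM μ (klFlowFrameU L M β U μ (m + 1)), frameLevel_eq_zero_sub_evalM μ (klFlowFrameU L M β U μ m),
    klFlowFrameU_succ, evalM_fsub]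
  ring

/-! ## §2 The increment data from (I-F jets) -/

/-- **The increment data of the `m`-th flow step** from `FlowPieceJetsAt … R m`: `|e_{K_{m+1}} − e_{K_m}| ≤ Gfr₀·uPow 0 U·4^{−2m}`,
`‖D(e_{K_{m+1}} − e_{K_m})‖ ≤ Gfr₁·uPow 1 U·4^{−m}`, `‖D²(…)‖ ≤ Gfr₂·uPow 2 U`, `‖D³(…)‖ ≤ Gfr₃·uPow 3 U·4^{m}` (written with the jets' exponents
`(i − 2)·m`). -/
theorem flowPiece_increment_data {β U μ : ℝ} {R : RenConsts} {m : ℕ} (hJ : FlowPieceJetsAt L M β U μ R m) :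
    (∀ p : Momentum, |frameLevel μ (klFlowFrameU L M β U μ (m + 1)) p - frameLevel μ (klFlowFrameU L M β U μ m) p| ≤
        R.Gfr 0 * uPow 0 U * (4 : ℝ) ^ ((((0 : ℕ) : ℤ) - 2) * m)) ∧
    (∀ p : Momentum, ‖fderiv ℝ (fun q : Momentum => frameLevel μ (klFlowFrameU L M β U μ (m + 1)) q - frameLevel μ (klFlowFrameU L M β U μ m) q) p‖ ≤
        R.Gfr 1 * uPow 1 U * (4 : ℝ) ^ ((((1 : ℕ) : ℤ) - 2) * m)) ∧
    (∀ p : Momentum, ‖iteratedFDeriv ℝ 2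
        (fun q : Momentum => frameLevel μ (klFlowFrameU L M β U μ (m + 1)) q - frameLevel μ (klFlowFrameU L M β U μ m) q) p‖ ≤
        R.Gfr 2 * uPow 2 U * (4 : ℝ) ^ ((((2 : ℕ) : ℤ) - 2) * m)) ∧
    (∀ p : Momentum, ‖iteratedFDeriv ℝ 3
        (fun q : Momentum => frameLevel μ (klFlowFrameU L M β U μ (m + 1)) q - frameLevel μ (klFlowFrameU L M β U μ m) q) p‖ ≤
        R.Gfr 3 * uPow 3 U * (4 : ℝ) ^ ((((3 : ℕ) : ℤ) - 2) * m)) := by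
  have hF := frameLevel_klFlowFrameU_succ_sub (L := L) (M := M) β U μ m
  refine ⟨fun p => ?_, fun p => ?_, fun p => ?_, fun p => ?_⟩
  · have h := hJ 0 (by norm_num) p
    rw [norm_iteratedFDeriv_zero, Real.norm_eq_abs] at h
    have e := congrFun hF p
    rw [e]; exact h
  · have h := hJ 1 (by norm_num) p
    rw [norm_iteratedFDeriv_one] at h
    rw [hF]; exact h
  · rw [hF]; exact hJ 2 (by norm_num) p
  · rw [hF]; exact hJ 3 (by norm_num) p

/-! ## §3 The truncated band jets of a partial flow frame -/

/-- **`‖D^i e_{K_m}‖ ≤ 4^i + Σ_{m′<m} Gfr i·uPow i U·4^{(i−2)m′}`** for `1 ≤ i ≤ 4`, from (I-F jets) at every `m′ < m` (`e_{K_m} = e_0 − evalM K_m`,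
`‖D^i e_0‖ ≤ 4^i`, `evalM K_m = −Σ_{m′<m} evalM (klFlowPiece m′)`). -/
theorem norm_iteratedFDeriv_frameLevel_klFlowFrameU_le {β U μ : ℝ} {R : RenConsts} {m i : ℕ} (hi : 1 ≤ i) (hi4 : i ≤ 4)
    (hJ : ∀ m' < m, FlowPieceJetsAt L M β U μ R m') (p : Momentum) :
    ‖iteratedFDeriv ℝ i (frameLevel μ (klFlowFrameU L M β U μ m)) p‖ ≤
      (4 : ℝ) ^ i + ∑ m' ∈ range m, R.Gfr i * uPow i U * (4 : ℝ) ^ (((i : ℤ) - 2) * m') := by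
  have hfun : frameLevel μ (klFlowFrameU L M β U μ m) = fun q => frameLevel μ 0 q + (-1 : ℝ) • evalM (klFlowFrameU L M β U μ m) q := by
    funext q; rw [frameLevel_eq_zero_sub_evalM μ (klFlowFrameU L M β U μ m)]; simp; ring
  have hg : ContDiff ℝ i (fun q : Momentum => (-1 : ℝ) • evalM (klFlowFrameU L M β U μ m) q) := (contDiff_evalM _).const_smul _
  rw [hfun, fun_iteratedFDeriv_add_apply (EngineV8.contDiff_frameLevel μ 0).contDiffAt hg.contDiffAt,
    iteratedFDeriv_const_smul_apply' (contDiff_evalM _).contDiffAt]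
  refine (norm_add_le _ _).trans (add_le_add (norm_iteratedFDeriv_frameLevel_zero_le_pow μ hi p) ?_)
  rw [norm_smul, Real.norm_eq_abs, abs_neg, abs_one, one_mul]
  exact norm_iteratedFDeriv_evalM_klFlowFrameU_le_sum (pj := fun m' j => R.Gfr j * uPow j U * (4 : ℝ) ^ (((j : ℤ) - 2) * m'))
    (fun m' hm' q => hJ m' hm' i hi4 q) p

/-- **The band data of the partial flow frame `K_m`** in the forms the pair lemmas consume: `‖De_{K_m}‖ ≤ 4 + Σ_{m′<m} Gfr₁·uPow 1 U·4^{−m′}`,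
`‖D²e_{K_m}‖ ≤ 16 + Σ_{m′<m} Gfr₂·uPow 2 U`, `‖D³e_{K_m}‖ ≤ 64 + Σ_{m′<m} Gfr₃·uPow 3 U·4^{m′}`. -/
theorem flowFrame_band_data {β U μ : ℝ} {R : RenConsts} {m : ℕ} (hJ : ∀ m' < m, FlowPieceJetsAt L M β U μ R m') :
    (∀ p : Momentum, ‖fderiv ℝ (frameLevel μ (klFlowFrameU L M β U μ m)) p‖ ≤
        (4 : ℝ) ^ (1 : ℕ) + ∑ m' ∈ range m, R.Gfr 1 * uPow 1 U * (4 : ℝ) ^ ((((1 : ℕ) : ℤ) - 2) * m')) ∧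
    (∀ p : Momentum, ‖iteratedFDeriv ℝ 2 (frameLevel μ (klFlowFrameU L M β U μ m)) p‖ ≤
        (4 : ℝ) ^ (2 : ℕ) + ∑ m' ∈ range m, R.Gfr 2 * uPow 2 U * (4 : ℝ) ^ ((((2 : ℕ) : ℤ) - 2) * m')) ∧
    (∀ p : Momentum, ‖iteratedFDeriv ℝ 3 (frameLevel μ (klFlowFrameU L M β U μ m)) p‖ ≤
        (4 : ℝ) ^ (3 : ℕ) + ∑ m' ∈ range m, R.Gfr 3 * uPow 3 U * (4 : ℝ) ^ ((((3 : ℕ) : ℤ) - 2) * m')) := by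
  refine ⟨fun p => ?_, fun p => norm_iteratedFDeriv_frameLevel_klFlowFrameU_le (by norm_num) (by norm_num) hJ p,
    fun p => norm_iteratedFDeriv_frameLevel_klFlowFrameU_le (by norm_num) (by norm_num) hJ p⟩
  rw [← norm_iteratedFDeriv_one]
  exact norm_iteratedFDeriv_frameLevel_klFlowFrameU_le (by norm_num) (by norm_num) hJ p

end Summit.HubbardSuperconductivity.HubbardSuperconductivity.Theorems.EngineV8

end
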